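import Summits.AtomisticToContinuum.HydrodynamicLimit.Theorems.ImplosionDichotomyDenseExcursionMemberCoreChart
import Summits.AtomisticToContinuum.HydrodynamicLimit.Theorems.ImplosionDichotomyDenseExcursionMemberCoreKidder

/-!
# A classical hard-sphere solution read in a chart solves `AthermalEulerAt (Z (· σ³))`
# (line `r2-one-mode-two-conditions`, stub `stub_chartReading`, L1 of skeleton v8)

Crux `Summit.AtomisticToContinuum.HydrodynamicLimit.Theses.ImplosionDichotomy.DenseExcursion`
(stmt-AtomisticToContinuum-12586), line `r2-one-mode-two-conditions`, registered stub
`stub_chartReading : HsChartReading` (statement `HsChartReading` copied VERBATIM from the skeleton, §0d).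

**Content.** The `σ > 0` twin of the landed `σ = 0` statement
`KidderKnobMelnikov.memberCore_chart_solves` (`…DenseExcursionMemberCoreChart.lean`). Let `Z : ℝ → ℝ` be `C^∞`
with `hsCompressibility = Z` on `[0, η₀]`, and let `IsHardSphereEulerSolution σ T ρ u θ`, `σ > 0`, have packing
`ρ σ³ < η₀` on `[0, T) × 𝕋³`. Since `ρ > 0`, the packing lies in `[0, η₀]`, so the hard-sphere pressure FIELD is
`hsPressure σ ρ θ = ρ θ hsCompressibility(ρσ³) = ρ θ ζ(ρ)` with the globally smooth law `ζ r = Z (r σ³)`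
(`hsPressure_eq_law`). Hence the three primitive point relations
`IsHardSphereEulerSolution.timeDeriv_density_eq / density_mul_timeDeriv_velocity_eq / timeDeriv_temperature_eq`
(`HardSphereEulerPrimitiveForm.lean`, law `ζ` on `J = univ`) hold on `[0, T) × 𝕋³`; reading the torus operators
in the chart `v ↦ x₀ + proj v` exactly as in the `σ = 0` file (`Torus.timeDerivWithin = deriv` at interior
times `0 < t < T`; `torusPartialDeriv_chart`; `gradient_apply_eq_fderiv`, `fderiv_apply_coord`,
`deriv_apply_coord` of `…MemberCoreKidder.lean` for coordinates) gives
`AthermalEulerAt (fun r => Z (r * σ ^ 3))` for the chart fields at every `(t, y) ∈ (0, T) × ℝ³`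
(`athermalEulerAt_chart_hs`). Joint smoothness of the chart fields on `[0, T) × ℝ³` is `contDiffOn_chart`
(any `σ`). Folklore multivariable calculus over the tree's torus calculus; no cited facts.
-/

noncomputable section

open Set Filter Topology
open scoped ContDiff

namespace Summit.AtomisticToContinuum.HydrodynamicLimit.Theorems.R2OneModeTwoConditions

open Literature.MathematicalPhysics.KineticTheory
open Literature.Analysis.FunctionSpaces
open Summit.AtomisticToContinuum.HydrodynamicLimit.Theorems.KidderKnobMelnikov (AthermalEulerAt HsEulerConeLocality)

/-! ## §0 The registered statement (verbatim from the line skeleton, §0d) -/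

/-- CHART READING of a classical hard-sphere solution (the `σ > 0` twin of the landed `memberCore_chart_solves`): if
`Z` is smooth and agrees with `hsCompressibility` on `[0, η₀]`, then every classical hard-sphere Euler solution on `𝕋³`
whose packing stays `< η₀` on `[0, T)`, read in any chart `y ↦ x₀ + proj y`, has `C^∞` fields on the slab
`[0, T) × ℝ³` solving, at interior times, the primitive athermal system `AthermalEulerAt ζ` with `ζ(r) = Z(r σ³)`. -/
def HsChartReading : Prop :=
  ∀ (Z : ℝ → ℝ) (η₀ : ℝ), 0 < η₀ → ContDiff ℝ ∞ Z → Set.EqOn hsCompressibility Z (Set.Icc 0 η₀) →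
  ∀ (σ T : ℝ) (ρ θ : ℝ → T3 → ℝ) (u : ℝ → T3 → V3), 0 < σ → IsHardSphereEulerSolution σ T ρ u θ →
    (∀ t ∈ Set.Ico 0 T, ∀ x, ρ t x * σ ^ 3 < η₀) →
    ∀ x₀ : T3,
      (ContDiffOn ℝ ∞ (fun p : ℝ × V3 => ρ p.1 (x₀ + Torus.proj p.2)) (Set.Ico 0 T ×ˢ Set.univ) ∧
        ContDiffOn ℝ ∞ (fun p : ℝ × V3 => θ p.1 (x₀ + Torus.proj p.2)) (Set.Ico 0 T ×ˢ Set.univ) ∧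
        ContDiffOn ℝ ∞ (fun p : ℝ × V3 => u p.1 (x₀ + Torus.proj p.2)) (Set.Ico 0 T ×ˢ Set.univ)) ∧
      ∀ t ∈ Set.Ioo 0 T, ∀ y : V3,
        AthermalEulerAt (fun r => Z (r * σ ^ 3)) (fun s v => ρ s (x₀ + Torus.proj v))
          (fun s v => θ s (x₀ + Torus.proj v)) (fun s v => u s (x₀ + Torus.proj v)) t y

/-! ## §1 The pressure field below the threshold and the equations in the chart -/

namespace ChartReadingProof

open Summit.AtomisticToContinuum.HydrodynamicLimit.Theorems.KidderKnobMelnikov.MemberCoreProof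
  (torusPartialDeriv_chart contDiffOn_chart deriv_apply_coord fderiv_apply_coord gradient_apply_eq_fderiv)
open Literature.Analysis.FluidPDE (IsentropicEuler.clm_apply_eq_sum)

section Equations

variable {Z : ℝ → ℝ} {η₀ σ T : ℝ} {ρ θ : ℝ → T3 → ℝ} {u : ℝ → T3 → V3}

/-- Below the threshold the hard-sphere pressure FIELD is the athermal law `p = ρ θ ζ(ρ)` with
`ζ r = Z (r σ³)`: `ρ > 0`, `σ > 0` and packing `< η₀` put `ρσ³ ∈ [0, η₀]`, where `hsCompressibility = Z`.
[folklore] -/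
theorem hsPressure_eq_law (hEq : EqOn hsCompressibility Z (Icc 0 η₀)) (hσ : 0 < σ)
    (hE : IsHardSphereEulerSolution σ T ρ u θ) (hpack : ∀ t ∈ Ico 0 T, ∀ x, ρ t x * σ ^ 3 < η₀) :
    ∀ s ∈ Ico 0 T, ∀ z : T3,
      hsPressure σ (ρ s z) (θ s z) = ρ s z * θ s z * (fun r => Z (r * σ ^ 3)) (ρ s z) := by
  intro s hs z
  have h0 : 0 ≤ ρ s z * σ ^ 3 := mul_nonneg (hE.density_pos s hs z).le (pow_nonneg hσ.le 3)
  simp only [hsPressure, hEq ⟨h0, (hpack s hs z).le⟩]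

/-- **A classical hard-sphere torus solution of packing `< η₀`, read in a chart, solves
`AthermalEulerAt (fun r => Z (r * σ ^ 3))` at interior times** (`Z` smooth, `= hsCompressibility` on
`[0, η₀]`). [folklore] -/
theorem athermalEulerAt_chart_hs (hZ : ContDiff ℝ ∞ Z) (hEq : EqOn hsCompressibility Z (Icc 0 η₀))
    (hσ : 0 < σ) (hE : IsHardSphereEulerSolution σ T ρ u θ)
    (hpack : ∀ t ∈ Ico 0 T, ∀ x, ρ t x * σ ^ 3 < η₀) (x₀ : T3) {t : ℝ} (ht : t ∈ Ioo 0 T) (y : V3) :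
    AthermalEulerAt (fun r => Z (r * σ ^ 3)) (fun s v => ρ s (x₀ + Torus.proj v))
      (fun s v => θ s (x₀ + Torus.proj v)) (fun s v => u s (x₀ + Torus.proj v)) t y := by
  -- adapted from `KidderKnobMelnikov.MemberCoreProof.athermalEulerAt_chart` (the `σ = 0`, `ζ ≡ 1` case)
  have ht' : t ∈ Ico 0 T := Ioo_subset_Ico_self ht
  have hti : t ∈ interior (Ico 0 T) := by rwa [interior_Ico]
  have hnhd : Ico 0 T ∈ 𝓝 t := mem_interior_iff_mem_nhds.1 hti
  have hρJ : ∀ s ∈ Ico 0 T, ∀ z, ρ s z ∈ (univ : Set ℝ) := fun _ _ _ => mem_univ _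
  have hζ : ContDiffOn ℝ ∞ (fun r => Z (r * σ ^ 3)) univ :=
    (hZ.comp (contDiff_id.mul contDiff_const)).contDiffOn
  have hp := hsPressure_eq_law hEq hσ hE hpack
  -- the primitive equations at `(t, x₀ + proj y)`
  have h1 := hE.timeDeriv_density_eq ht' (x₀ + Torus.proj y)
  have h2 := fun j => hE.density_mul_timeDeriv_velocity_eq isOpen_univ hζ hρJ hp ht' (x₀ + Torus.proj y) j
  have h3 := hE.timeDeriv_temperature_eq isOpen_univ hζ hρJ hp ht' (x₀ + Torus.proj y)
  -- regularity of the slices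
  have hρ1 : Torus.IsContDiff 1 (ρ t) := (hE.smooth_density.isSmooth_slice ht').isContDiff (by simp)
  have hθ1 : Torus.IsContDiff 1 (θ t) := (hE.smooth_temperature.isSmooth_slice ht').isContDiff (by simp)
  have hu1 : Torus.IsContDiff 1 (u t) := (hE.smooth_velocity.isSmooth_slice ht').isContDiff (by simp)
  have huj1 : ∀ j, Torus.IsContDiff 1 (fun z => u t z j) := fun j => HsEulerCalc.isContDiff_apply_coord hu1 j
  have hUs : DifferentiableAt ℝ (fun v => u t (x₀ + Torus.proj v)) y :=
    (((hE.smooth_velocity.isSmooth_slice ht').liftAt x₀).differentiable (by simp)).differentiableAt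
  have hUt : DifferentiableAt ℝ (fun s => u s (x₀ + Torus.proj y)) t :=
    (hE.smooth_velocity.hasDerivWithinAt_slice ht' (x₀ + Torus.proj y)).differentiableWithinAt.differentiableAt
      hnhd
  -- torus operators in the chart
  have cTρ : Torus.timeDerivWithin (Ico 0 T) ρ t (x₀ + Torus.proj y) =
      deriv (fun s => ρ s (x₀ + Torus.proj y)) t :=
    Torus.timeDerivWithin_of_mem_interior hti _
  have cTθ : Torus.timeDerivWithin (Ico 0 T) θ t (x₀ + Torus.proj y) =
      deriv (fun s => θ s (x₀ + Torus.proj y)) t :=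
    Torus.timeDerivWithin_of_mem_interior hti _
  have cTu : ∀ j, Torus.timeDerivWithin (Ico 0 T) (fun s z => u s z j) t (x₀ + Torus.proj y) =
      deriv (fun s => u s (x₀ + Torus.proj y)) t j := fun j => by
    rw [Torus.timeDerivWithin_of_mem_interior hti, deriv_apply_coord hUt]
    rfl
  have cXρ : ∀ i, Torus.partialDeriv i (ρ t) (x₀ + Torus.proj y) =
      fderiv ℝ (fun v => ρ t (x₀ + Torus.proj v)) y (EuclideanSpace.single i 1) :=
    fun i => torusPartialDeriv_chart hρ1 i x₀ y
  have cXθ : ∀ i, Torus.partialDeriv i (θ t) (x₀ + Torus.proj y) =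
      fderiv ℝ (fun v => θ t (x₀ + Torus.proj v)) y (EuclideanSpace.single i 1) :=
    fun i => torusPartialDeriv_chart hθ1 i x₀ y
  have cXu : ∀ i j, Torus.partialDeriv i (fun z => u t z j) (x₀ + Torus.proj y) =
      fderiv ℝ (fun v => u t (x₀ + Torus.proj v) j) y (EuclideanSpace.single i 1) :=
    fun i j => torusPartialDeriv_chart (huj1 j) i x₀ y
  simp only [cTρ, cXρ, cXu] at h1
  simp only [cTu, cXρ, cXθ, cXu] at h2
  simp only [cTθ, cXθ, cXu] at h3
  unfold AthermalEulerAt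
  dsimp only
  refine ⟨?_, ?_, ?_⟩
  · rw [h1, IsentropicEuler.clm_apply_eq_sum (fderiv ℝ (fun v => ρ t (x₀ + Torus.proj v)) y)]
    simp only [smul_eq_mul, fderiv_apply_coord hUs, Finset.mul_sum, ← Finset.sum_add_distrib,
      ← Finset.sum_neg_distrib]
    refine Finset.sum_eq_zero fun i _ => ?_
    ring
  · ext j
    simp only [PiLp.add_apply, PiLp.smul_apply, PiLp.zero_apply, smul_eq_mul, gradient_apply_eq_fderiv,
      fderiv_apply_coord hUs]
    rw [IsentropicEuler.clm_apply_eq_sum (fderiv ℝ (fun v => u t (x₀ + Torus.proj v) j) y)]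
    simp only [smul_eq_mul]
    linear_combination h2 j
  · rw [h3, IsentropicEuler.clm_apply_eq_sum (fderiv ℝ (fun v => θ t (x₀ + Torus.proj v)) y)]
    simp only [smul_eq_mul, fderiv_apply_coord hUs]
    ring

end Equations

end ChartReadingProof

/-! ## §2 The registered stub -/

open ChartReadingProof KidderKnobMelnikov.MemberCoreProof in
/-- **CHART READING of a classical hard-sphere solution** (stub L1 of line `r2-one-mode-two-conditions`): for `Z`
smooth with `hsCompressibility = Z` on `[0, η₀]` and a classical hard-sphere Euler solution on `𝕋³` of packing
`< η₀` on `[0, T)`, the chart fields at any `x₀` are `C^∞` on `[0, T) × ℝ³` (`contDiffOn_chart`) and solve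
`AthermalEulerAt (fun r => Z (r * σ ^ 3))` at every `0 < t < T` (`athermalEulerAt_chart_hs`). [folklore] -/
theorem stub_chartReading : HsChartReading :=
  fun _ _ _ hZ hEq _ _ _ _ _ hσ hE hpack x₀ =>
    ⟨⟨contDiffOn_chart hE.smooth_density x₀, contDiffOn_chart hE.smooth_temperature x₀,
      contDiffOn_chart hE.smooth_velocity x₀⟩,
      fun _ ht y => athermalEulerAt_chart_hs hZ hEq hσ hE hpack x₀ ht y⟩

end Summit.AtomisticToContinuum.HydrodynamicLimit.Theorems.R2OneModeTwoConditions

end
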